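import Summits.ResolutionOfSingularities.ResolutionOfSingularities.Theses.Valuative
import Literature.AlgebraicGeometry.Resolution.ProperModelsPatching
import Literature.AlgebraicGeometry.Resolution.ProperModelsPatchingGluing
import Literature.AlgebraicGeometry.Resolution.ProperModelsRegLeification
import Literature.AlgebraicGeometry.Resolution.ProperModelsExtension
import Literature.AlgebraicGeometry.Resolution.ZariskiPatchingProperModels
import Literature.AlgebraicGeometry.Morphisms.OpenGluing
import Literature.AlgebraicGeometry.Morphisms.OpenGluingProofs
import Literature.AlgebraicGeometry.Morphisms.NagataCompactification

/-!
# drefute gen 3 — state certificate of the 7-stub set of line `sandwiched-gluing`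
# (crux stmt-ResolutionOfSingularities-0642, `Valuative.PatchingRel`), against the tree at 2026-08-16T02:00Z

Each stub is restated with its REGISTERED signature verbatim (workitem `stubs[]`, active, lead
prover-line-stmt-ResolutionOfSingularities-0642-0, 2026-08-16T00:32Z). S1–S5 are closed by `exact`
with a tree declaration (so they are THEOREMS, not refutable); S6 (named fact, Conrad 2007 Thm 4.1)
and S7 (open atom SAND⁺) are the only `sorry`s. The last theorem certifies that the line is now
closed modulo S6 ∧ S7 only (S4 `OpenGluing` was discharged in the tree at 01:42Z:
`OpenGluing_holds`).
-/

open CategoryTheory AlgebraicGeometry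
open Literature.AlgebraicGeometry.Resolution Literature.AlgebraicGeometry.Morphisms

namespace DrefuteG3

/-- S1 (registered signature verbatim) — a theorem: `resolutionInChar_of_properTwoModelPatching_of_relLU`. -/
theorem S1 : ∀ p : ℕ, p.Prime → ProperModel.TwoModelPatching.{0} p → (∀ (k K : Type) [Field k] [CharP k p] [Field K] [Algebra k K], (⊤ : IntermediateField k K).FG → ∀ O : ValuationSubring K, (∀ c : k, algebraMap k K c ∈ O) → ∀ R : Subalgebra k K, R.FG → R.toSubring ≤ O.toSubring → ∃ (A : Subalgebra k K) (h : A.toSubring ≤ O.toSubring), R ≤ A ∧ A.FG ∧ IsFractionRing A K ∧ IsRegularLocalRing (Localization.AtPrime (Ideal.comap (Subring.inclusion h) (IsLocalRing.maximalIdeal O)))) → ResolutionInChar.{0} p :=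
  fun _ _ hZ hLU => resolutionInChar_of_properTwoModelPatching_of_relLU (fun k _ _ K _ _ _ => hZ k K) hLU

/-- S2 (verbatim) — a theorem: `ProperModel.regLeification_of_local`. -/
theorem S2 : ∀ p : ℕ, (∀ (k : Type) [Field k] (K : Type) [Field K] [Algebra k K] (P : ProperModel k K) (U : P.X.Opens) (Y : Scheme.{0}) [IsIntegral Y] (g : Y ⟶ (U : Scheme.{0})) [IsProper g], IsBirational g → ∃ (P' : ProperModel k K) (φ : P'.Hom P) (i : Y ⟶ P'.X), IsOpenImmersion i ∧ IsPullback i g φ.f U.ι) → ProperModel.LocalRegLeification.{0} p → ProperModel.RegLeification.{0} p :=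
  fun p hext hloc => ProperModel.regLeification_of_local p hext hloc

/-- S3 (verbatim) — a theorem: `SandwichedGluing.localRegLeification_of_openGluing_of_sandwiched`. -/
theorem S3 : ∀ p : ℕ, OpenGluing.{0} → SandwichedStrongResolution.{0} p → ProperModel.LocalRegLeification.{0} p :=
  SandwichedGluing.localRegLeification_of_openGluing_of_sandwiched

/-- S4 (verbatim) — a theorem since 01:42Z: `OpenGluing_holds`. -/
theorem S4 : OpenGluing.{0} := OpenGluing_holds

/-- S5 (verbatim) — a theorem: `SandwichedGluing.extension_of_nagata` (also `ProperModel.exists_extension_of_nagata`). -/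
theorem S5 : NagataCompactification.{0} → ∀ (k : Type) [Field k] (K : Type) [Field K] [Algebra k K] (P : ProperModel k K) (U : P.X.Opens) (Y : Scheme.{0}) [IsIntegral Y] (g : Y ⟶ (U : Scheme.{0})) [IsProper g], IsBirational g → ∃ (P' : ProperModel k K) (φ : P'.Hom P) (i : Y ⟶ P'.X), IsOpenImmersion i ∧ IsPullback i g φ.f U.ι :=
  SandwichedGluing.extension_of_nagata

/-- S6 (verbatim) — NAMED FACT (Conrad 2007 Thm 4.1 / Stacks 0F41); not provable here, true in print. -/
theorem S6 : NagataCompactification.{0} := by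
  sorry

/-- S7 (verbatim) — the OPEN ATOM SAND⁺ (CP2019 Thm 1.1 (i)–(ii) in dim ≤ 3; open in dim ≥ 4). -/
theorem S7 : ∀ p : ℕ, p.Prime → SandwichedStrongResolution.{0} p := by
  sorry

/-- The line modulo its two unproved stubs: `Nagata → (∀ p prime, SAND⁺ p) → PatchingRel`,
sorry-free given its hypotheses (S4 discharged by `OpenGluing_holds`). -/
theorem patchingRel_of_nagata_sand (hN : NagataCompactification.{0})
    (hS : ∀ p : ℕ, p.Prime → SandwichedStrongResolution.{0} p) :
    Summit.ResolutionOfSingularities.ResolutionOfSingularities.Theses.Valuative.PatchingRel :=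
  fun p hp hLU => SandwichedGluing.resolutionInChar_of_nagata_openGluing_sand p hN OpenGluing_holds (hS p hp) hLU

/-- Hence the crux from the 7 stubs (only S6, S7 carry `sorry`). -/
theorem patchingRel_of_stubs :
    Summit.ResolutionOfSingularities.ResolutionOfSingularities.Theses.Valuative.PatchingRel :=
  patchingRel_of_nagata_sand S6 S7

end DrefuteG3
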